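import Summits.NavierStokesRegularity.NavierStokesRegularity.Theses.LevelSetModeration

/-!
# Route LevelSetModeration — Cauchy–Schwarz in time, in the shape of the crux `HighSpeedPressureWork`

Support file for item stmt-NavierStokesRegularity-18149. Every line reduces the pressure-work
pairing `PW_c(t) = -∫₀ᵗ∫ (1-c/|u|)₊ ∇q·u` to SLICE bounds of the form
`P(τ) ≤ √a(τ) · √b(τ)` (Cauchy–Schwarz in space on the super-level set `{|u(τ)| > c}`), with
`a`, `b` the slices of two space–time quantities whose time integrals over `(0, T)` appear under the
square roots of the crux's right-hand side (`F M^m V_c(T)` and `D_c(T)`, both `toReal` of lower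
Lebesgue integrals). This file records the passage from slice bounds to the crux's shape once and
for all, with the Bochner / `toReal` conventions of the route handled (a non-integrable pairing has
integral `0`; the integrals over `(0, t)` are dominated by those over `(0, T)`):

* `levelSetModeration_sqrt_mul_sqrt_le_half_add` — `√a √b ≤ (a + b)/2`;
* `levelSetModeration_integral_sqrt_mul_sqrt_le` — `∫_{(0,t)} √a √b ≤ √(∫⁻_{(0,T)} A) √(∫⁻_{(0,T)} B)` for
  `a = A.toReal`, `b = B.toReal`, `A, B` a.e.-measurable on `(0,t)` with finite integrals on `(0,T)`;
* `levelSetModeration_setIntegral_le_sqrt_mul_sqrt` — the same conclusion for any `f ≤ √a √b` a.e.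
  on `(0, t)` (no integrability of `f` needed).
-/

noncomputable section

-- single-conjunct summit: `Summit.<Summit>.<Problem>` repeats the name by the D-0017 layout
set_option linter.dupNamespace false

namespace Summit.NavierStokesRegularity.NavierStokesRegularity.Theorems

open MeasureTheory Set Filter Topology
open scoped ENNReal

/-- `√a · √b ≤ (a + b) / 2` for `a, b ≥ 0`. [folklore] -/
theorem levelSetModeration_sqrt_mul_sqrt_le_half_add {a b : ℝ} (ha : 0 ≤ a) (hb : 0 ≤ b) :
    Real.sqrt a * Real.sqrt b ≤ (a + b) / 2 := by
  nlinarith [sq_nonneg (Real.sqrt a - Real.sqrt b), Real.sq_sqrt ha, Real.sq_sqrt hb,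
    Real.sqrt_nonneg a, Real.sqrt_nonneg b]

/-- **Cauchy–Schwarz in time, `ℝ≥0∞` slices.** Let `A, B : ℝ → ℝ≥0∞` be a.e.-measurable on
`(0, t)` with `∫⁻_{(0,T)} A < ∞`, `∫⁻_{(0,T)} B < ∞`, `t ≤ T`. Then
`∫_{τ ∈ (0,t)} √(A τ).toReal · √(B τ).toReal ≤ √((∫⁻_{(0,T)} A).toReal) · √((∫⁻_{(0,T)} B).toReal)`
(Hölder with exponents `2, 2` for the Bochner integral, `integral_toReal`, monotonicity in the
domain). [folklore] -/
theorem levelSetModeration_integral_sqrt_mul_sqrt_le {t T : ℝ} (ht : t ≤ T) {A B : ℝ → ℝ≥0∞}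
    (hA : AEMeasurable A (volume.restrict (Ioo 0 t)))
    (hB : AEMeasurable B (volume.restrict (Ioo 0 t)))
    (hAfin : ∫⁻ τ in Ioo 0 T, A τ ≠ ∞) (hBfin : ∫⁻ τ in Ioo 0 T, B τ ≠ ∞) :
    ∫ τ in Ioo 0 t, Real.sqrt (A τ).toReal * Real.sqrt (B τ).toReal ≤
      Real.sqrt (∫⁻ τ in Ioo 0 T, A τ).toReal * Real.sqrt (∫⁻ τ in Ioo 0 T, B τ).toReal := by
  set μ : Measure ℝ := volume.restrict (Ioo 0 t) with hμ
  have hsub : Ioo 0 t ⊆ Ioo 0 T := Ioo_subset_Ioo le_rfl ht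
  have hAfin' : ∫⁻ τ, A τ ∂μ ≠ ∞ := ne_top_of_le_ne_top hAfin (lintegral_mono_set hsub)
  have hBfin' : ∫⁻ τ, B τ ∂μ ≠ ∞ := ne_top_of_le_ne_top hBfin (lintegral_mono_set hsub)
  -- the real slices
  set a : ℝ → ℝ := fun τ => (A τ).toReal with ha
  set b : ℝ → ℝ := fun τ => (B τ).toReal with hb
  have ha0 : ∀ τ, 0 ≤ a τ := fun τ => ENNReal.toReal_nonneg
  have hb0 : ∀ τ, 0 ≤ b τ := fun τ => ENNReal.toReal_nonneg
  have ha_meas : AEMeasurable a μ := hA.ennreal_toReal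
  have hb_meas : AEMeasurable b μ := hB.ennreal_toReal
  have hsa_meas : AEStronglyMeasurable (fun τ => Real.sqrt (a τ)) μ :=
    (Real.continuous_sqrt.measurable.comp_aemeasurable ha_meas).aestronglyMeasurable
  have hsb_meas : AEStronglyMeasurable (fun τ => Real.sqrt (b τ)) μ :=
    (Real.continuous_sqrt.measurable.comp_aemeasurable hb_meas).aestronglyMeasurable
  have ha_int : Integrable a μ := integrable_toReal_of_lintegral_ne_top hA hAfin'
  have hb_int : Integrable b μ := integrable_toReal_of_lintegral_ne_top hB hBfin'
  -- `√a, √b ∈ L²`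
  have hsa : MemLp (fun τ => Real.sqrt (a τ)) (ENNReal.ofReal 2) μ := by
    rw [ENNReal.ofReal_ofNat, memLp_two_iff_integrable_sq hsa_meas]
    refine ha_int.congr (Eventually.of_forall fun τ => ?_)
    simp only [Real.sq_sqrt (ha0 τ)]
  have hsb : MemLp (fun τ => Real.sqrt (b τ)) (ENNReal.ofReal 2) μ := by
    rw [ENNReal.ofReal_ofNat, memLp_two_iff_integrable_sq hsb_meas]
    refine hb_int.congr (Eventually.of_forall fun τ => ?_)
    simp only [Real.sq_sqrt (hb0 τ)]
  -- Hölder `2, 2`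
  have hH := integral_mul_le_Lp_mul_Lq_of_nonneg (μ := μ) Real.HolderConjugate.two_two
    (Eventually.of_forall fun τ => Real.sqrt_nonneg (a τ))
    (Eventually.of_forall fun τ => Real.sqrt_nonneg (b τ)) hsa hsb
  -- identify the right-hand side
  have hra : (∫ τ, Real.sqrt (a τ) ^ (2 : ℝ) ∂μ) = (∫⁻ τ, A τ ∂μ).toReal := by
    rw [← integral_toReal hA (ae_lt_top' hA hAfin')]
    refine integral_congr_ae (Eventually.of_forall fun τ => ?_)
    show Real.sqrt (a τ) ^ (2 : ℝ) = (A τ).toReal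
    rw [Real.rpow_two]
    exact Real.sq_sqrt (ha0 τ)
  have hrb : (∫ τ, Real.sqrt (b τ) ^ (2 : ℝ) ∂μ) = (∫⁻ τ, B τ ∂μ).toReal := by
    rw [← integral_toReal hB (ae_lt_top' hB hBfin')]
    refine integral_congr_ae (Eventually.of_forall fun τ => ?_)
    show Real.sqrt (b τ) ^ (2 : ℝ) = (B τ).toReal
    rw [Real.rpow_two]
    exact Real.sq_sqrt (hb0 τ)
  rw [hra, hrb] at hH
  have hsqa : ((∫⁻ τ, A τ ∂μ).toReal) ^ (1 / (2 : ℝ)) ≤ Real.sqrt (∫⁻ τ in Ioo 0 T, A τ).toReal := by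
    rw [← Real.sqrt_eq_rpow]
    exact Real.sqrt_le_sqrt (ENNReal.toReal_mono hAfin (lintegral_mono_set hsub))
  have hsqb : ((∫⁻ τ, B τ ∂μ).toReal) ^ (1 / (2 : ℝ)) ≤ Real.sqrt (∫⁻ τ in Ioo 0 T, B τ).toReal := by
    rw [← Real.sqrt_eq_rpow]
    exact Real.sqrt_le_sqrt (ENNReal.toReal_mono hBfin (lintegral_mono_set hsub))
  calc ∫ τ in Ioo 0 t, Real.sqrt (A τ).toReal * Real.sqrt (B τ).toReal
      ≤ ((∫⁻ τ, A τ ∂μ).toReal) ^ (1 / (2 : ℝ)) * ((∫⁻ τ, B τ ∂μ).toReal) ^ (1 / (2 : ℝ)) := hH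
    _ ≤ Real.sqrt (∫⁻ τ in Ioo 0 T, A τ).toReal * Real.sqrt (∫⁻ τ in Ioo 0 T, B τ).toReal := by
        gcongr

/-- **From slice bounds to the crux's shape.** If `f τ ≤ √(A τ).toReal · √(B τ).toReal` for a.e.
`τ ∈ (0, t)`, with `A, B : ℝ → ℝ≥0∞` a.e.-measurable on `(0, t)`, `∫⁻_{(0,T)} A < ∞`,
`∫⁻_{(0,T)} B < ∞` and `t ≤ T`, then
`∫_{τ ∈ (0,t)} f ≤ √((∫⁻_{(0,T)} A).toReal) · √((∫⁻_{(0,T)} B).toReal)` — whether or not `f` is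
integrable (a non-integrable `f` has Bochner integral `0`). With `f` the slice pressure-work pairing,
`A τ = F M^m |{|u(τ)| > c}|` (or the slice of any moderated-pressure quantity) and `B τ` the slice
level-set dissipation `∫ 1_{|u|>c} |∇|u||²`, the right-hand side is literally that of
`HighSpeedPressureWork`. [folklore] -/
theorem levelSetModeration_setIntegral_le_sqrt_mul_sqrt :
    ∀ (t T : ℝ) (f : ℝ → ℝ) (A B : ℝ → ENNReal), t ≤ T → AEMeasurable A (MeasureTheory.volume.restrict (Set.Ioo 0 t)) → AEMeasurable B (MeasureTheory.volume.restrict (Set.Ioo 0 t)) → (∫⁻ τ in Set.Ioo 0 T, A τ) ≠ ⊤ → (∫⁻ τ in Set.Ioo 0 T, B τ) ≠ ⊤ → (∀ᵐ τ ∂(MeasureTheory.volume.restrict (Set.Ioo 0 t)), f τ ≤ Real.sqrt (A τ).toReal * Real.sqrt (B τ).toReal) → ∫ τ in Set.Ioo 0 t, f τ ≤ Real.sqrt (∫⁻ τ in Set.Ioo 0 T, A τ).toReal * Real.sqrt (∫⁻ τ in Set.Ioo 0 T, B τ).toReal := by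
  intro t T f A B ht hA hB hAfin hBfin hf
  have hmain := levelSetModeration_integral_sqrt_mul_sqrt_le ht hA hB hAfin hBfin
  by_cases hfi : Integrable f (volume.restrict (Ioo 0 t))
  · refine le_trans (integral_mono_ae hfi ?_ hf) hmain
    -- integrability of `√a √b ≤ (a + b)/2`
    set μ : Measure ℝ := volume.restrict (Ioo 0 t)
    have hsub : Ioo 0 t ⊆ Ioo 0 T := Ioo_subset_Ioo le_rfl ht
    have ha_int : Integrable (fun τ => (A τ).toReal) μ :=
      integrable_toReal_of_lintegral_ne_top hA (ne_top_of_le_ne_top hAfin (lintegral_mono_set hsub))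
    have hb_int : Integrable (fun τ => (B τ).toReal) μ :=
      integrable_toReal_of_lintegral_ne_top hB (ne_top_of_le_ne_top hBfin (lintegral_mono_set hsub))
    have hmeas : AEStronglyMeasurable
        (fun τ => Real.sqrt (A τ).toReal * Real.sqrt (B τ).toReal) μ :=
      ((Real.continuous_sqrt.measurable.comp_aemeasurable hA.ennreal_toReal).mul
        (Real.continuous_sqrt.measurable.comp_aemeasurable hB.ennreal_toReal)).aestronglyMeasurable
    refine ((ha_int.add hb_int).div_const 2).mono' hmeas (Eventually.of_forall fun τ => ?_)
    rw [Real.norm_of_nonneg (mul_nonneg (Real.sqrt_nonneg _) (Real.sqrt_nonneg _))]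
    exact levelSetModeration_sqrt_mul_sqrt_le_half_add ENNReal.toReal_nonneg ENNReal.toReal_nonneg
  · rw [integral_undef hfi]
    exact mul_nonneg (Real.sqrt_nonneg _) (Real.sqrt_nonneg _)

end Summit.NavierStokesRegularity.NavierStokesRegularity.Theorems
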